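import Summits.CriticalPhenomena.PercolationContinuityZ3.Theorems.PercNearOneGluingNoHeavyQuantBlockCombCount
import Summits.CriticalPhenomena.PercolationContinuityZ3.Theorems.PercNearOneGluingNoHeavyQuantBlobWalkModel
import Summits.CriticalPhenomena.PercolationContinuityZ3.Theorems.PercNearOneGluingNoHeavyQuantFarTreeComb
import HarnessLib

/-!
# QUANT lane R8, FAR on trees: BLOCK-COMBS — `Quant.FarTreeRow`'s conclusion from the exchange inequality; the EQUAL-PRIVATE-GATE
# family unconditionally (LEAD-NOTES-G10 N21 (3)); the prefix-window regime route (N21 (2))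

builds on p205010 (kernel theorem, internal audit signed; external expert review pending)

Support file (`--supports stmt-CriticalPhenomena-4575`), QUANT lane typer seat prim-quant-stmt (gen 14), rung R8 of
`run/shared/lean/prim/quant/LADDER.md`; lead g10 ask (lane INBOX 2026-08-20T21:25Z (2)(i)).  Theorems only; no definitions (the
`local notation3` `CB[a, p, m]` of `…QuantBlobWalk.lean`, verbatim), no sorries, standard axioms.

Setting and data as in `…QuantBlockCombCount.lean` (`Quant.blockComb_count_eq`): gate coordinates of `Quant.FarTreeRow`, a block-comb
around the relay `a` (chain `P a`, `x = ∏_{P a} q`, terminal block of size `c`), blobs `Q 0 … Q (K−1)` root-first with sizes `sz`, private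
gates `p`, chain weights `w`.  By `Quant.blockComb_exchange_identity` (N21 (1)) the far-relay row at layer `j` for the block-comb,
`P(#{y ∈ A : P y open} ≤ j) ≤ 1 − x`, is EQUIVALENT to the walk-side exchange inequality of `…QuantBlobWalk.lean`; this file cashes the two
walk-side routes the lead proved there.

* `Quant.blockComb_sum_marginals` — `Σ_{y∈A} ∏_{P y} q = c·x + Σ_{k<K} sz k · ∏_{Q k} q` (fibrewise).
* `Quant.farTree_blockComb_of_exchange` — exchange inequality `x·CB[K](j − c) ≤ Σ_{k<K} (w k − x)·p k·(CB[k] j − CB[k](j − sz k))` ⟹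
  `P(N ≤ j) ≤ 1 − x` (the identity, read backwards).
* `Quant.farTree_blockComb_equalGates_enum`, `Quant.farTree_blockComb_equalGates` — **FAR AT EVERY LAYER FOR BLOCK-COMBS WITH EQUAL PRIVATE
  GATES** (N21 (3)): ancestor finsets of a rooted forest (`y ∈ P x → P y ⊆ P x`; members of `P x` pairwise comparable), relays `A ∋ a` with `a`
  least likely, distinct fibres of `P` on `A` meeting only inside `P a` (block-comb), and ONE value `g` of the private gate `∏_{P b ∖ P a} q` over
  all `b ∈ A` off the terminal block; then `2j < Σ_{b∈A} ∏_{P b} q` and `1 − ∏_{P a} q ≤ t` give `P(#{b ∈ A : P b open} ≤ j) ≤ t`.  Proof =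
  the identity + `BlobWalk.exchange_of_const'` (iid block-star inequality from `Quant.halfMean_smallBall`), budget `2j < EN ≤ g·(A + c)`.
  HONEST PLACEMENT: this family (block-stars `w ≡ 1` and, for `g = 1`, chains; sizes / chain weights / terminal block arbitrary) is ALSO
  contained in p1 g7's bare-leaf cell (`Quant.farTree_blockComb_cell`, contraction route) once the chain of `a` below the lowest attachment
  point is merged into one gate — a coordinate change not performed in the kernel; the present file is the SECOND, walk-calculus proof, and its
  point is that every window-inequality route of N21 ((PW), vertex forms, (GW)) now lands against `farTree_blockComb_of_exchange`.
* `Quant.farTree_blockComb_of_prefixWindow` — **the regime route (N21 (2))**: for any block-comb (`a` least likely), PREFIX WINDOW DOMINATION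
  of its blob walk at level `j` (`Σ_{k<m} danger_k ≤ Σ_{k<m} opportunity_k`, `m ≤ K`, the hypothesis of `BlobWalk.exchange_of_prefixWindow`)
  and `2j < EN` give the far-relay row at layer `j`.  CAUTION: the blanket conjectures (TW-strong)/(TW-H4) of N21 (4)/(4′), which were to supply
  prefix domination in the regime `A·min p + c > 2j`, are FALSE as stated (prim-postcont-1 gen 38, lane INBOX 2026-08-20T22:04Z; kernel record
  `…QuantBlobWindowFalse.lean`, same seat): prefix domination is a per-instance hypothesis here, to be certified where it holds (e.g. at the
  `{g,1}`-vertices of lead g11's `BlobWalk.prefixWindow_of_vertices`, `…QuantBlobWindowVertex.lean`, p239143).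
[this work]; [cite: KozmaNitzan2024, Conjecture 3 (p. 15)] (the gluing rows `Quant.FarTreeRow` serves); product measure
[cite: Grimmett1999, §1.3 p. 10].
-/

noncomputable section

namespace Summit.CriticalPhenomena.PercolationContinuityZ3.Theorems

namespace Quant

open Finset MeasureTheory
open Literature.Probability.LatticeModels
open Literature.Probability.Percolation
open scoped Classical

/-- `CB[a, p, m] t` = probability that the open mass of the first `m` blobs (sizes `a`, gates `p`) is `≤ t` (the recursion of
`…QuantBlobWalk.lean`, verbatim). -/
local notation3 "CB[" a ", " p ", " m "]" =>
  (Nat.rec (motive := fun _ => ℤ → ℝ) (fun t => if (0 : ℤ) ≤ t then (1 : ℝ) else 0)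
    (fun n f t => (p : ℕ → ℝ) n * f (t - ((a : ℕ → ℕ) n : ℤ)) + (1 - (p : ℕ → ℝ) n) * f t) (m : ℕ))


namespace BlobWalk

/-- `CB[a, p, m]` depends only on the gates of the first `m` blobs (private copy of lead g11's `BlobWalk.CB_congr`,
`…QuantBlobWindowVertex.lean`, to keep this file's imports on the tree side). [folklore] -/
private theorem CB_congr_gates (a : ℕ → ℕ) (p p' : ℕ → ℝ) : ∀ m : ℕ, (∀ k, k < m → p k = p' k) →
    ∀ t : ℤ, CB[a, p, m] t = CB[a, p', m] t := by
  intro m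
  induction m with
  | zero => intro _ t; rfl
  | succ m ih =>
    intro hp t
    have ih' := ih (fun k hk => hp k (by omega))
    rw [CB_succ a p m t, CB_succ a p' m t, ih', ih', hp m (by omega)]

end BlobWalk

variable {ι : Type*} [Fintype ι] [DecidableEq ι]

/-! ### Bookkeeping: the mean and the light event -/

omit [Fintype ι] in
/-- **The mean of a block-comb, fibrewise**: `Σ_{y∈A} ∏_{P y} q = c · ∏_{P a} q + Σ_{k<K} sz k · ∏_{Q k} q`. [folklore] -/
theorem blockComb_sum_marginals (P : ι → Finset ι) (q : ι → unitInterval) (a : ι) :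
    ∀ (K : ℕ) (A : Finset ι) (Q : ℕ → Finset ι) (sz : ℕ → ℕ) (c : ℕ),
      c = (A.filter fun y => P y = P a).card →
      (∀ k, k < K → sz k = (A.filter fun y => P y = Q k).card) →
      (∀ y ∈ A, P y = P a ∨ ∃ k, k < K ∧ P y = Q k) →
      (∀ k, k < K → Q k ≠ P a) →
      (∀ k k', k < K → k' < K → Q k = Q k' → k = k') →
      ∑ y ∈ A, ∏ z ∈ P y, (q z : ℝ) =
        c * ∏ z ∈ P a, (q z : ℝ) + ∑ k ∈ Finset.range K, (sz k : ℝ) * ∏ z ∈ Q k, (q z : ℝ) := by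
  intro K
  induction K with
  | zero =>
    intro A Q sz c hc _ hcover _ _
    have hall : ∀ y ∈ A, P y = P a := fun y hy => by
      rcases hcover y hy with h | ⟨k, hk, _⟩
      · exact h
      · omega
    rw [Finset.sum_range_zero, add_zero, Finset.sum_congr rfl fun y hy => by rw [hall y hy], Finset.sum_const, nsmul_eq_mul, hc,
      Finset.filter_true_of_mem hall]
  | succ K ih =>
    intro A Q sz c hc hsz hcover hQne hinj
    set A' : Finset ι := A.filter fun y => P y ≠ Q 0 with hA'
    have hQ0 : Q 0 ≠ P a := hQne 0 (by omega)
    have hc' : c = (A'.filter fun y => P y = P a).card := by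
      rw [hc]; congr 1; ext y; simp only [hA', Finset.mem_filter]
      exact ⟨fun ⟨hy, hP⟩ => ⟨⟨hy, by rw [hP]; exact hQ0.symm⟩, hP⟩, fun ⟨⟨hy, _⟩, hP⟩ => ⟨hy, hP⟩⟩
    have hsz' : ∀ k, k < K → (fun k => sz (k + 1)) k = (A'.filter fun y => P y = (fun k => Q (k + 1)) k).card := by
      intro k hk
      simp only
      rw [hsz (k + 1) (by omega)]
      congr 1; ext y; simp only [hA', Finset.mem_filter]
      refine ⟨fun ⟨hy, hP⟩ => ⟨⟨hy, ?_⟩, hP⟩, fun ⟨⟨hy, _⟩, hP⟩ => ⟨hy, hP⟩⟩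
      rw [hP]
      exact fun h => by have := hinj (k + 1) 0 (by omega) (by omega) h; omega
    have hcover' : ∀ y ∈ A', P y = P a ∨ ∃ k, k < K ∧ P y = (fun k => Q (k + 1)) k := by
      intro y hy
      obtain ⟨hyA, hyQ⟩ := Finset.mem_filter.1 hy
      rcases hcover y hyA with h | ⟨k, hk, hky⟩
      · exact Or.inl h
      · cases k with
        | zero => exact absurd hky hyQ
        | succ k => exact Or.inr ⟨k, by omega, hky⟩
    have hQne' : ∀ k, k < K → (fun k => Q (k + 1)) k ≠ P a := fun k hk => hQne (k + 1) (by omega)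
    have hinj' : ∀ k k', k < K → k' < K → (fun k => Q (k + 1)) k = (fun k => Q (k + 1)) k' → k = k' := by
      intro k k' hk hk' h
      have := hinj (k + 1) (k' + 1) (by omega) (by omega) h
      omega
    have IH := ih A' (fun k => Q (k + 1)) (fun k => sz (k + 1)) c hc' hsz' hcover' hQne' hinj'
    have hfib : A.filter (fun y => ¬ P y ≠ Q 0) = A.filter (fun y => P y = Q 0) :=
      Finset.filter_congr fun y _ => not_not
    have hfibsum : ∑ y ∈ A.filter (fun y => P y = Q 0), ∏ z ∈ P y, (q z : ℝ) = (sz 0 : ℝ) * ∏ z ∈ Q 0, (q z : ℝ) := by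
      rw [Finset.sum_congr rfl fun y hy => by rw [(Finset.mem_filter.1 hy).2], Finset.sum_const, nsmul_eq_mul,
        ← hsz 0 (by omega)]
    rw [← Finset.sum_filter_add_sum_filter_not A (fun y => P y ≠ Q 0), IH, hfib, hfibsum,
      Finset.sum_range_succ' (fun k => (sz k : ℝ) * ∏ z ∈ Q k, (q z : ℝ))]
    ring

omit [Fintype ι] [DecidableEq ι] in
/-- The light event `{N ≤ j}` is the complement of `{j + 1 ≤ N}` (integer threshold form). [folklore] -/
theorem blockComb_light_eq_compl (P : ι → Finset ι) (A : Finset ι) (j : ℕ) :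
    {ω : Set ι | (A.filter fun y => ((P y : Finset ι) : Set ι) ⊆ ω).card ≤ j} =
      {ω : Set ι | (j : ℤ) + 1 ≤ (((A.filter fun y => ((P y : Finset ι) : Set ι) ⊆ ω).card : ℕ) : ℤ)}ᶜ := by
  ext ω
  simp only [Set.mem_setOf_eq, Set.mem_compl_iff, not_le]
  constructor
  · intro h; exact_mod_cast Nat.lt_succ_of_le h
  · intro h
    have h' : ((A.filter fun y => ((P y : Finset ι) : Set ι) ⊆ ω).card : ℤ) < (j : ℤ) + 1 := h
    have h'' : (A.filter fun y => ((P y : Finset ι) : Set ι) ⊆ ω).card < j + 1 := by exact_mod_cast h'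
    omega

/-! ### FAR from the exchange inequality -/

/-- **The exchange inequality gives the far-relay row** (`Quant.blockComb_exchange_identity` read backwards): for a block-comb as in
`Quant.blockComb_count_eq` and a layer `j`, `x · CB[K](j − c) ≤ Σ_{k<K} (w k − x) · p k · (CB[k] j − CB[k](j − sz k))` implies
`P(#{y ∈ A : P y open} ≤ j) ≤ 1 − x`. [this work] -/
theorem farTree_blockComb_of_exchange (P : ι → Finset ι) (q : ι → unitInterval) (a : ι) (x : ℝ)
    (hx : x = ∏ y ∈ P a, (q y : ℝ)) (K : ℕ) (A : Finset ι) (Q : ℕ → Finset ι) (sz : ℕ → ℕ) (c : ℕ) (p w : ℕ → ℝ)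
    (ha : a ∈ A) (hc : c = (A.filter fun y => P y = P a).card)
    (hsz : ∀ k, k < K → sz k = (A.filter fun y => P y = Q k).card)
    (hcover : ∀ y ∈ A, P y = P a ∨ ∃ k, k < K ∧ P y = Q k)
    (hQne : ∀ k, k < K → Q k ≠ P a)
    (hinj : ∀ k k', k < K → k' < K → Q k = Q k' → k = k')
    (hmono : ∀ k k', k ≤ k' → k' < K → Q k ∩ P a ⊆ Q k' ∩ P a)
    (hdisj : ∀ k k', k < K → k' < K → k ≠ k' → Q k ∩ Q k' ⊆ P a)
    (hpdef : ∀ k, p k = ∏ y ∈ Q k \ P a, (q y : ℝ))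
    (hwdef : ∀ k, w k = ∏ y ∈ Q k ∩ P a, (q y : ℝ)) (j : ℕ)
    (hex : x * CB[sz, p, K] ((j : ℤ) - (c : ℤ)) ≤
      ∑ k ∈ Finset.range K, (w k - x) * p k * (CB[sz, p, k] (j : ℤ) - CB[sz, p, k] ((j : ℤ) - (sz k : ℤ)))) :
    (prodBernoulli q).real
        {ω : Set ι | (A.filter fun y => ((P y : Finset ι) : Set ι) ⊆ ω).card ≤ j} ≤ 1 - x := by
  have hmeas : ∀ T : Set (Set ι), MeasurableSet T := fun T => (Set.toFinite T).measurableSet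
  have hid := blockComb_exchange_identity P q a x hx K A Q sz c p w ha hc hsz hcover hQne hinj hmono hdisj hpdef hwdef
    (j : ℤ) (Int.natCast_nonneg j)
  rw [blockComb_light_eq_compl P A j, probReal_compl_eq_one_sub (hmeas _)]
  linarith

/-! ### Equal private gates -/

/-- **FAR at every layer for block-combs with EQUAL private gates — enumerated form** (N21 (3)).  Data as in `Quant.blockComb_count_eq`;
if every blob has the same private gate `p k = g` (`k < K`), `a` is least likely (`x ≤ w k · g`), and `2j < Σ_{y∈A} ∏_{P y} q`, then
`P(#{y ∈ A : P y open} ≤ j) ≤ 1 − x`.  Proof: `2j < EN ≤ g·(Σ sz + c)` and `BlobWalk.exchange_of_const'`. [this work] -/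
theorem farTree_blockComb_equalGates_enum (P : ι → Finset ι) (q : ι → unitInterval) (a : ι) (x : ℝ)
    (hx : x = ∏ y ∈ P a, (q y : ℝ)) (K : ℕ) (A : Finset ι) (Q : ℕ → Finset ι) (sz : ℕ → ℕ) (c : ℕ) (p w : ℕ → ℝ)
    (ha : a ∈ A) (hc : c = (A.filter fun y => P y = P a).card)
    (hsz : ∀ k, k < K → sz k = (A.filter fun y => P y = Q k).card)
    (hcover : ∀ y ∈ A, P y = P a ∨ ∃ k, k < K ∧ P y = Q k)
    (hQne : ∀ k, k < K → Q k ≠ P a)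
    (hinj : ∀ k k', k < K → k' < K → Q k = Q k' → k = k')
    (hmono : ∀ k k', k ≤ k' → k' < K → Q k ∩ P a ⊆ Q k' ∩ P a)
    (hdisj : ∀ k k', k < K → k' < K → k ≠ k' → Q k ∩ Q k' ⊆ P a)
    (hpdef : ∀ k, p k = ∏ y ∈ Q k \ P a, (q y : ℝ))
    (hwdef : ∀ k, w k = ∏ y ∈ Q k ∩ P a, (q y : ℝ))
    (g : ℝ) (hpg : ∀ k, k < K → p k = g) (hxw : ∀ k, k < K → x ≤ w k * g) (j : ℕ)
    (hEN : (2 * j : ℝ) < ∑ y ∈ A, ∏ z ∈ P y, (q z : ℝ)) :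
    (prodBernoulli q).real
        {ω : Set ι | (A.filter fun y => ((P y : Finset ι) : Set ι) ⊆ ω).card ≤ j} ≤ 1 - x := by
  have hq0 : ∀ y, (0 : ℝ) ≤ q y := fun y => (q y).2.1
  have hq1 : ∀ y, (q y : ℝ) ≤ 1 := fun y => (q y).2.2
  have hprod01 : ∀ s : Finset ι, 0 ≤ ∏ y ∈ s, (q y : ℝ) ∧ ∏ y ∈ s, (q y : ℝ) ≤ 1 := fun s =>
    ⟨Finset.prod_nonneg fun y _ => hq0 y, Finset.prod_le_one (fun y _ => hq0 y) fun y _ => hq1 y⟩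
  have hx0 : 0 ≤ x := by rw [hx]; exact (hprod01 _).1
  have hx1 : x ≤ 1 := by rw [hx]; exact (hprod01 _).2
  have hw01 : ∀ k, 0 ≤ w k ∧ w k ≤ 1 := fun k => by rw [hwdef k]; exact hprod01 _
  have hp01 : ∀ k, 0 ≤ p k ∧ p k ≤ 1 := fun k => by rw [hpdef k]; exact hprod01 _
  have hsum := blockComb_sum_marginals P q a K A Q sz c hc hsz hcover hQne hinj
  have hsplit : ∀ k, ∏ z ∈ Q k, (q z : ℝ) = w k * p k := fun k => by
    rw [hwdef k, hpdef k]; exact (Finset.prod_inter_mul_prod_sdiff (Q k) (P a) fun z => (q z : ℝ)).symm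
  rw [hsum, ← hx] at hEN
  rcases Nat.eq_zero_or_pos K with hK0 | hKpos
  · -- no blobs: `EN = c·x > 2j` forces `c ≥ 2j + 1 > j`, so `CB[0](j − c) = 0`
    subst hK0
    refine farTree_blockComb_of_exchange P q a x hx 0 A Q sz c p w ha hc hsz hcover hQne hinj hmono hdisj hpdef hwdef j ?_
    rw [Finset.sum_range_zero] at hEN ⊢
    have h1 : (2 * j : ℝ) < c := by nlinarith [mul_le_of_le_one_right (Nat.cast_nonneg c) hx1]
    have h2 : 2 * j < c := by exact_mod_cast h1
    rw [BlobWalk.CB_of_neg sz p 0 _ (by omega), mul_zero]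
  · by_cases hg : g ≤ 0
    · -- then `x ≤ w 0 · g ≤ 0`: the bound `1 − x = 1` is trivial
      have hx0' : x ≤ 0 := (hxw 0 hKpos).trans (mul_nonpos_iff.2 (Or.inl ⟨(hw01 0).1, hg⟩))
      have : x = 0 := le_antisymm hx0' hx0
      rw [this, sub_zero]
      exact measureReal_le_one
    · have hg0 : 0 < g := lt_of_not_ge hg
      have hg1 : g ≤ 1 := by rw [← hpg 0 hKpos]; exact (hp01 0).2
      refine farTree_blockComb_of_exchange P q a x hx K A Q sz c p w ha hc hsz hcover hQne hinj hmono hdisj hpdef hwdef j ?_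
      -- the recursion only sees the gates `p k = g`, `k < K`
      have hCB : ∀ m, m ≤ K → ∀ t : ℤ, CB[sz, p, m] t = CB[sz, (fun _ => g), m] t := fun m hm t =>
        BlobWalk.CB_congr_gates sz p (fun _ => g) m (fun k hk => hpg k (by omega)) t
      rw [hCB K le_rfl, Finset.sum_congr rfl fun k hk => by
        rw [hCB k (le_of_lt (Finset.mem_range.1 hk)), hCB k (le_of_lt (Finset.mem_range.1 hk)), hpg k (Finset.mem_range.1 hk)]]
      -- the budget: `2j < c·x + Σ sz k · (w k · g) ≤ g · (Σ sz k + c)`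
      have hmean : (2 * j : ℝ) < g * (((∑ k ∈ Finset.range K, sz k : ℕ) : ℝ) + c) := by
        have hxg : x ≤ g := (hxw 0 hKpos).trans (by nlinarith [(hw01 0).2, hg0.le])
        have hterm : ∀ k ∈ Finset.range K, (sz k : ℝ) * ∏ z ∈ Q k, (q z : ℝ) ≤ g * (sz k : ℝ) := by
          intro k hk
          rw [hsplit k, hpg k (Finset.mem_range.1 hk)]
          have : w k * g ≤ g := by nlinarith [(hw01 k).2, hg0.le]
          nlinarith [Nat.cast_nonneg (α := ℝ) (sz k)]
        have hs := Finset.sum_le_sum hterm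
        rw [← Finset.mul_sum] at hs
        have hcx : (c : ℝ) * x ≤ g * c := by nlinarith [Nat.cast_nonneg (α := ℝ) c]
        push_cast
        linarith
      exact BlobWalk.exchange_of_const' sz g hg0 hg1 K j c x w hx0 hxw hmean

/-- **FAR AT EVERY LAYER FOR BLOCK-COMBS WITH EQUAL PRIVATE GATES** (gate coordinates of `Quant.FarTreeRow`; LEAD-NOTES-G10 N21 (3)).
Ancestor finsets `P` of a rooted forest (`y ∈ P x → P y ⊆ P x`; members of `P x` pairwise comparable), gates `q`, relays `A ∋ a` with `a`
least likely; BLOCK-COMB: distinct fibres of `P` on `A` meet only inside the chain `P a` (`P b ≠ P b' → P b ∩ P b' ⊆ P a`); EQUAL PRIVATE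
GATES: one value `g = ∏_{P b ∖ P a} q` for every `b ∈ A` with `P b ≠ P a`.  Then `2j < Σ_{b∈A} ∏_{P b} q` and `1 − ∏_{P a} q ≤ t` give
`P(#{b ∈ A : ↑(P b) ⊆ ω} ≤ j) ≤ t` — `Quant.FarTreeRow`'s conclusion on this family, every layer.  (Also inside p1 g7's bare-leaf cell after a
coordinate merge — see the module docstring; this is the walk-calculus proof.) [this work] -/
theorem farTree_blockComb_equalGates (P : ι → Finset ι)
    (h2 : ∀ x, ∀ y ∈ P x, P y ⊆ P x) (h3 : ∀ x, ∀ y ∈ P x, ∀ z ∈ P x, y ∈ P z ∨ z ∈ P y)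
    (q : ι → unitInterval) (A : Finset ι) (j : ℕ) (t : ℝ) (a : ι) (ha : a ∈ A)
    (hmin : ∀ b ∈ A, ∏ y ∈ P a, (q y : ℝ) ≤ ∏ y ∈ P b, (q y : ℝ))
    (hcomb : ∀ b ∈ A, ∀ b' ∈ A, P b ≠ P b' → P b ∩ P b' ⊆ P a)
    (g : ℝ) (hgate : ∀ b ∈ A, P b ≠ P a → ∏ y ∈ P b \ P a, (q y : ℝ) = g)
    (hEN : (2 * j : ℝ) < ∑ b ∈ A, ∏ y ∈ P b, (q y : ℝ))
    (ht : 1 - ∏ y ∈ P a, (q y : ℝ) ≤ t) :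
    (prodBernoulli q).real {ω : Set ι | (A.filter fun b => ((P b : Finset ι) : Set ι) ⊆ ω).card ≤ j} ≤ t := by
  -- enumerate the fibres of `P` off the terminal block, root-first
  set S : Finset (Finset ι) := (A.image P).erase (P a) with hS
  obtain ⟨Q, hQmem, hQinj, hQcov, hQmono⟩ :=
    exists_enum_mono (fun Q : Finset ι => (Q ∩ P a).card) (P a) S.card S rfl
  set K := S.card with hK
  have hQS : ∀ k, k < K → Q k ≠ P a ∧ ∃ y ∈ A, P y = Q k := fun k hk => by
    obtain ⟨hne, hmem⟩ := Finset.mem_erase.1 (hQmem k hk)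
    obtain ⟨y, hy, hyQ⟩ := Finset.mem_image.1 hmem
    exact ⟨hne, y, hy, hyQ⟩
  set x : ℝ := ∏ y ∈ P a, (q y : ℝ) with hx
  set sz : ℕ → ℕ := fun k => (A.filter fun y => P y = Q k).card with hsz
  set c : ℕ := (A.filter fun y => P y = P a).card with hc
  set p : ℕ → ℝ := fun k => ∏ y ∈ Q k \ P a, (q y : ℝ) with hp
  set w : ℕ → ℝ := fun k => ∏ y ∈ Q k ∩ P a, (q y : ℝ) with hw
  have hcover : ∀ y ∈ A, P y = P a ∨ ∃ k, k < K ∧ P y = Q k := by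
    intro y hy
    by_cases h : P y = P a
    · exact Or.inl h
    · obtain ⟨k, hk, hkQ⟩ := hQcov (P y) (Finset.mem_erase.2 ⟨h, Finset.mem_image_of_mem P hy⟩)
      exact Or.inr ⟨k, hk, hkQ.symm⟩
  have hmono : ∀ k k', k ≤ k' → k' < K → Q k ∩ P a ⊆ Q k' ∩ P a := by
    intro k k' hkk' hk'
    obtain ⟨_, y, _, hyQ⟩ := hQS k (by omega)
    obtain ⟨_, y', _, hy'Q⟩ := hQS k' hk'
    rw [← hyQ, ← hy'Q]
    refine subset_of_nested_of_card_le (comb_downsets_nested P h2 h3 a y y') ?_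
    rw [hyQ, hy'Q]; exact hQmono k k' hkk' hk'
  have hdisj : ∀ k k', k < K → k' < K → k ≠ k' → Q k ∩ Q k' ⊆ P a := by
    intro k k' hk hk' hne
    obtain ⟨_, y, hy, hyQ⟩ := hQS k hk
    obtain ⟨_, y', hy', hy'Q⟩ := hQS k' hk'
    rw [← hyQ, ← hy'Q]
    refine hcomb y hy y' hy' fun h => hne (hQinj k k' hk hk' ?_)
    rw [← hyQ, ← hy'Q, h]
  have hpg : ∀ k, k < K → p k = g := by
    intro k hk
    obtain ⟨hne, y, hy, hyQ⟩ := hQS k hk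
    simp only [hp]
    rw [← hyQ]
    exact hgate y hy (by rw [hyQ]; exact hne)
  have hxw : ∀ k, k < K → x ≤ w k * g := by
    intro k hk
    obtain ⟨hne, y, hy, hyQ⟩ := hQS k hk
    rw [← hpg k hk]
    simp only [hw, hp]
    rw [Finset.prod_inter_mul_prod_sdiff (Q k) (P a) fun z => (q z : ℝ), ← hyQ]
    exact hmin y hy
  have hfar := farTree_blockComb_equalGates_enum P q a x hx K A Q sz c p w ha hc (fun k _ => rfl) hcover
    (fun k hk => (hQS k hk).1) hQinj hmono hdisj (fun k => rfl) (fun k => rfl) g hpg hxw j hEN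
  exact hfar.trans (by linarith)

/-! ### The regime route: prefix window domination -/

/-- **FAR from prefix window domination (N21 (2)).**  Data as in `Quant.blockComb_count_eq`, `a` least likely (`x ≤ w k · p k`, `k < K`),
`2j < Σ_{y∈A} ∏_{P y} q`; if the blob walk satisfies PREFIX WINDOW DOMINATION at level `j` — for every `m ≤ K`,
`Σ_{k<m} (CB[k](j − c − T k) − CB[k](j − c − T k − sz k)) ≤ Σ_{k<m} (CB[k] j − CB[k](j − sz k))`, `T k = Σ_{i∈(k,K)} sz i` (dangers
dominated by opportunities on every prefix) — then `P(#{y ∈ A : P y open} ≤ j) ≤ 1 − x`.  (`BlobWalk.exchange_of_prefixWindow` +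
the identity; the chain weights are non-increasing because the chain parts are nested.) [this work] -/
theorem farTree_blockComb_of_prefixWindow (P : ι → Finset ι) (q : ι → unitInterval) (a : ι) (x : ℝ)
    (hx : x = ∏ y ∈ P a, (q y : ℝ)) (K : ℕ) (A : Finset ι) (Q : ℕ → Finset ι) (sz : ℕ → ℕ) (c : ℕ) (p w : ℕ → ℝ)
    (ha : a ∈ A) (hc : c = (A.filter fun y => P y = P a).card)
    (hsz : ∀ k, k < K → sz k = (A.filter fun y => P y = Q k).card)
    (hcover : ∀ y ∈ A, P y = P a ∨ ∃ k, k < K ∧ P y = Q k)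
    (hQne : ∀ k, k < K → Q k ≠ P a)
    (hinj : ∀ k k', k < K → k' < K → Q k = Q k' → k = k')
    (hmono : ∀ k k', k ≤ k' → k' < K → Q k ∩ P a ⊆ Q k' ∩ P a)
    (hdisj : ∀ k k', k < K → k' < K → k ≠ k' → Q k ∩ Q k' ⊆ P a)
    (hpdef : ∀ k, p k = ∏ y ∈ Q k \ P a, (q y : ℝ))
    (hwdef : ∀ k, w k = ∏ y ∈ Q k ∩ P a, (q y : ℝ))
    (hxw : ∀ k, k < K → x ≤ w k * p k) (j : ℕ)
    (hEN : (2 * j : ℝ) < ∑ y ∈ A, ∏ z ∈ P y, (q z : ℝ))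
    (hPW : ∀ m, m ≤ K →
      ∑ k ∈ Finset.range m,
          (CB[sz, p, k] ((j : ℤ) - (c : ℤ) - ((∑ i ∈ Finset.Ico (k + 1) K, sz i : ℕ) : ℤ)) -
            CB[sz, p, k] ((j : ℤ) - (c : ℤ) - ((∑ i ∈ Finset.Ico (k + 1) K, sz i : ℕ) : ℤ) - (sz k : ℤ))) ≤
        ∑ k ∈ Finset.range m, (CB[sz, p, k] (j : ℤ) - CB[sz, p, k] ((j : ℤ) - (sz k : ℤ)))) :
    (prodBernoulli q).real
        {ω : Set ι | (A.filter fun y => ((P y : Finset ι) : Set ι) ⊆ ω).card ≤ j} ≤ 1 - x := by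
  have hq0 : ∀ y, (0 : ℝ) ≤ q y := fun y => (q y).2.1
  have hq1 : ∀ y, (q y : ℝ) ≤ 1 := fun y => (q y).2.2
  have hprod01 : ∀ s : Finset ι, 0 ≤ ∏ y ∈ s, (q y : ℝ) ∧ ∏ y ∈ s, (q y : ℝ) ≤ 1 := fun s =>
    ⟨Finset.prod_nonneg fun y _ => hq0 y, Finset.prod_le_one (fun y _ => hq0 y) fun y _ => hq1 y⟩
  have hx0 : 0 ≤ x := by rw [hx]; exact (hprod01 _).1
  have hx1 : x ≤ 1 := by rw [hx]; exact (hprod01 _).2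
  have hp01 : ∀ k, 0 ≤ p k ∧ p k ≤ 1 := fun k => by rw [hpdef k]; exact hprod01 _
  have hsum := blockComb_sum_marginals P q a K A Q sz c hc hsz hcover hQne hinj
  refine farTree_blockComb_of_exchange P q a x hx K A Q sz c p w ha hc hsz hcover hQne hinj hmono hdisj hpdef hwdef j ?_
  refine BlobWalk.exchange_of_prefixWindow sz p hp01 K (j : ℤ) c x w hx0 ?_ ?_ hPW
  · -- `x ≤ w k · p k ≤ w i · p k` for `i ≤ k` (nested chain parts: `w` is non-increasing)
    intro i k hik hkK
    have hwk : w k ≤ w i := by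
      rw [hwdef k, hwdef i]
      exact Finset.prod_le_prod_of_subset_of_le_one (hmono i k hik hkK) (fun y _ => hq0 y) fun y _ _ => hq1 y
    exact (hxw k hkK).trans (mul_le_mul_of_nonneg_right hwk (hp01 k).1)
  · -- `j − c < Σ sz`: `2j < EN ≤ c + Σ sz`
    have hterm : ∀ k ∈ Finset.range K, (sz k : ℝ) * ∏ z ∈ Q k, (q z : ℝ) ≤ (sz k : ℝ) :=
      fun k _ => mul_le_of_le_one_right (Nat.cast_nonneg _) (hprod01 _).2
    have hs := Finset.sum_le_sum hterm
    have hcx : (c : ℝ) * ∏ z ∈ P a, (q z : ℝ) ≤ c := mul_le_of_le_one_right (Nat.cast_nonneg _) (hprod01 _).2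
    rw [hsum] at hEN
    have h1 : (2 * j : ℝ) < c + ∑ k ∈ Finset.range K, (sz k : ℝ) := by linarith
    have h2 : 2 * j < c + ∑ k ∈ Finset.range K, sz k := by exact_mod_cast h1
    have h3 : ((2 * j : ℕ) : ℤ) < ((c + ∑ k ∈ Finset.range K, sz k : ℕ) : ℤ) := Int.ofNat_lt.2 h2
    push_cast at h3 ⊢
    omega

end Quant

end Summit.CriticalPhenomena.PercolationContinuityZ3.Theorems

end
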